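import Literature.MathematicalPhysics.QuantumFieldTheory.Balaban1983to89.B9Eq34CurlGaugeModeWindow
import Literature.MathematicalPhysics.QuantumFieldTheory.Balaban1983to89.B9Eq326OperatorTower
import Literature.MathematicalPhysics.QuantumFieldTheory.Balaban1983to89.B9Eq384RemainderLetters

/-!
# `Balaban1983to89.B9Eq3120DeltaPiPrimeFormDiagonal` — T. Bałaban, *Propagators for lattice gauge theories in a background field*, Commun. Math. Phys. **99**
# (1985) 389–434 [Balaban1985BackgroundPropagators] (3.119)–(3.120) p. 419, (3.36) p. 396, p. 420 *«Δ′_π … is a small perturbation of Δ_a»*: THE FORM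
# DEFECT OF THE GAUGE-INVARIANT EXTENSION AGAINST THE HESSIAN, `|⟨u, (π†Δ^ηπ − Δ^η)v⟩| ≤ θ̄·α·N₁(u)N₁(v)` IN THE FLAT ENERGY WEIGHT, for print's
# `π = 1 − D_UG′R_k(U)D*_U` at the `k`-th-step letters — the θ-LETTER of `B9Eq3130HessianSlotPerturbationDiagonal`, modulo the two `λ`-letters of `G′R_kD*_U`

statement-level skeleton of published theorems with citation tags; proofs where landed; nothing here is a claim about the Yang–Mills mass gap

CITATION HEADER (lean-in-tree rule).  Audit cell `pub-balaban`, sub-cell `t4`, BINDER row NE9; filed by the row OWNER lineage `b2b-balaban-t4-ne9-p1`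
(gen 87; plan v7 «the Δ_π port» step (ii) = the assembly, `g87/DELTA-PI-PROGRAMME.md` §2 as amended in W-6 l.51573).  Sources READ by this lineage:
[Balaban1985BackgroundPropagators] pp. 392, 396, 419–421 (`paper:balaban1985-cmp99-background-propagators`, journal page = PDF page + 388).

THE PRINT (verbatim).  p. 419: *«(A, Δ_πA) = ⟨A − DG′RD*A, Δ(A − DG′RD*A)⟩ (3.119) … Let us now apply the second identity (3.117) to the right-hand side
of (3.119). It gives the equality [(3.120)] … The quadratic form Δ′_π is a small perturbation of Δ»*; p. 420: *«we will prove that this term is a small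
perturbation of Δ_a»*; (3.36) p. 396 *«|∂U′(p) − 1| < α₀η²»*.

WHY THIS FILE (cell context; DIAGNOSIS D-ne9p1-g87-1).  `B9Eq3130HessianSlotPerturbationDiagonal` (this generation) turns a form bound
`‖⟨u, Δ₁v⟩ − ⟨u, Δ^ηv⟩‖ ≤ θ·N₁(u)N₁(v)` on the Hessian slot into: strong coercivity, positivity and `G₁ − G₀ = O(θ)` for the `k`-th-step operator — print's
(3.130).  For print's slot `Δ₁ = π†Δ^ηπ` the bound is (3.120)'s smallness.  NE9 leaf-02's reading (INTENT-2 l.51525, = this lineage's W-6): the defect has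
THREE terms, each pairing `Δ^η = D*D + Δ′` with a PURE GAUGE MODE `D_Uλ_w`, `λ_w = G′R_k(U)D*_Uw`; the principal part sees the holonomy commutator
`D_U(D_Uλ)` (`B9Eq34CurlGaugeModeWindow`, `O(α)` with NO `η` loss under (3.36)), the curvature part is the small bilinear form of (3.69) — NO carrier
bridge to lit-balaban's (3.117) is needed.  This file is the ASSEMBLY, abstract in the Green's-function letter `G′` (`Gp`) so that it waits on no
definition: `π` is written out as `1 − D_U ∘ Gp ∘ R_k(U) ∘ D*_U` (= `B9Eq3119DeltaPiTower.piOfUk … Gp` by `rfl`).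

WHAT IS PROVED (sorry-free; no `def`, no `Prop` placeholder; no inequality of the paper asserted hypothesis-free).
* **`norm_form_defect_pi_le`** — for `U(b) ∈ U1` with mutually adjoint transporters (`hRS`), the bond window `‖U(b) − 1‖ ≤ αη`, the plaquette window
  `‖U(∂p) − 1‖ ≤ αη²`, `0 ≤ α ≤ 1`, `|η|^d∕c₀ ≤ ρ_w`, the trace letter `‖τX‖ ≤ C_τ‖X‖`, ANY linear `Gp` on the gauge parameters and the two DISPLAYED
  `λ`-letters `‖Gp(R_k(D*_Uw))‖ ≤ C_λ·N₁(w)`, `‖D_U(Gp(R_k(D*_Uw)))‖ ≤ C_λ′·N₁(w)` (`N₁(w) = √(‖curl₁w‖² + ‖div₁w‖² + ‖w‖²)`), and every `u, v`: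
  `‖⟨u, (π†Δ^η(U)π)v⟩ − ⟨u, Δ^η(U)v⟩‖ ≤ θ̄·α·N₁(u)N₁(v)`, `θ̄ = 2(a·b·C_λ + κ·C_λ′) + a²C_λ² + κC_λ′²` with `a = 2M_φ′M_φ√#DirPair` (the holonomy-commutator
  letter), `b = 1 + 8√d·M_φM_φ′` (`‖curl_Uw‖ ≤ b·N₁(w)`), `κ = 32dC_τM_φ²ρ_w` (the curvature letter at the plaquette window).
  MECHANISM: `⟨u, π†Δπv⟩ = ⟨πu, Δπv⟩` (`LinearMap.adjoint_inner_right`), `πw = w − D_Uλ_w`, three terms; each by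
  `B9Eq34CurlGaugeModeWindow.norm_inner_principalOpK_le` ∕ `norm_inner_hessOp_covDerivL2K_le` + `norm_covCurlL2K_covDerivL2K_le_window` +
  `B9Ineq369CurvatureOperatorBound.norm_inner_curvOp_le`, `‖curl_Uw − curl_1w‖ ≤ 8√dM_φM_φ′α‖w‖` (`B9Eq373DerivativeRemainderL2.norm_covCurlL2K_sub_le`).
HONEST SCOPE.  [folklore] three Cauchy–Schwarz steps on the cited letters; the two `λ`-letters ARE displayed (their supplier on the diagonal = the k-level
site coercivity `B9Thm311SitePrimeFormCoerciveTowerCanonical.exists_strong_site_coercive_tower_diagonal` — OFFER O-ne9p1-g87-1, a separate file); the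
windows, `hRS`, `ρ_w`, the trace letter stay HYPOTHESES; `L²`∕energy currency only; no current `J`, no (3.117) as printed, no operator norm of `Δ′_π`.  NOT
summit progress (cell pub-balaban: NE9 NOT PRINTED ∕ NOT PROVED; «NE9 ⇐ the named binders»; row WALLED ON A MODEL (O-NE9-1; #5 UNRULED); spine PROVED 0∕9;
rung (B)+1 finite T⁴ — NOT infinite volume, NOT mass gap, NOT BetaPertH, NOT Clay).  HONEST DEPENDENCY (cell line): continuum YM on T⁴ ⇐ BetaPertH ∧
nine spine estimates (0/9 proved); BetaPertH ⇐ (D1) ∧ (D4) ∧ CAP+tail; G-an2-4 gates asym, D1 and NE2/3/4.  NEW file; nothing modified.  Net new unproved facts: 0.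
-/

noncomputable section

open scoped InnerProductSpace ComplexConjugate BigOperators

namespace Literature.MathematicalPhysics.QuantumFieldTheory.Balaban1983to89.B9Eq3120DeltaPiPrimeFormDiagonal

open B4Sect5Torus (TSite)
open B9SectCLatticeCarrier (Bond DirPair)
open B11Eq103H1Complex (SiteL2K BondL2K covDerivL2K covDivL2K)
open B9Eq310HessianOperator (adTransportW hessOp hessOp_apply covCurlL2K principalOpK curvOp)
open B9Eq310DeltaPrime (plaqHolU)
open B9Eq315QTower (towerP)
open B9Eq326OperatorTower (RofUk)
open B7Prop1Explicit (U1 mem_U1)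
open B9Eq373DerivativeRemainderL2 (norm_covCurlL2K_sub_le)
open B9Ineq369CurvatureOperatorBound (norm_inner_curvOp_le)
open B9Eq34CurlGaugeModeWindow (norm_inner_principalOpK_le norm_inner_hessOp_covDerivL2K_le norm_covCurlL2K_covDerivL2K_le_window)

/-- `x ≤ √S` from `0 ≤ x` and `x² ≤ S`. [folklore] -/
private theorem le_sqrt_of_sq_le {x S : ℝ} (hx : 0 ≤ x) (h : x ^ 2 ≤ S) : x ≤ Real.sqrt S := by
  calc x = Real.sqrt (x ^ 2) := (Real.sqrt_sq hx).symm
    _ ≤ Real.sqrt S := Real.sqrt_le_sqrt h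

set_option maxHeartbeats 800000 in
/-- **THE FORM DEFECT OF `π†Δ^ηπ` AGAINST `Δ^η`, `π = 1 − D_U ∘ G′ ∘ R_k(U) ∘ D*_U`, IN THE FLAT ENERGY WEIGHT** — see the module header:
`‖⟨u, (π†Δ^η(U)π)v⟩ − ⟨u, Δ^η(U)v⟩‖ ≤ θ̄·α·N₁(u)N₁(v)` under the bond and plaquette windows (`0 ≤ α ≤ 1`), mutually adjoint unit-bounded transporters,
`|η|^d∕c₀ ≤ ρ_w`, the trace letter, and the two displayed `λ`-letters of `G′R_kD*_U`; `θ̄ = 2(abC_λ + κC_λ′) + a²C_λ² + κC_λ′²`,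
`a = 2M_φ′M_φ√#DirPair`, `b = 1 + 8√dM_φM_φ′`, `κ = 32dC_τM_φ²ρ_w`.  The θ-letter of `B9Eq3130HessianSlotPerturbationDiagonal` for print's slot (3.122).
[folklore] [cite: Balaban1985BackgroundPropagators, (3.119)–(3.120) p.419, (3.36) p.396, (3.69) p.404, p.420] -/
theorem norm_form_defect_pi_le {d : ℕ} (L : ℕ) [NeZero L] (m : Fin d → ℕ) [∀ i, NeZero (m i)] (n : ℕ)
    {𝔸 : Type*} [NormedRing 𝔸] [NormedAlgebra ℂ 𝔸] [CompleteSpace 𝔸] [NormOneClass 𝔸] [StarRing 𝔸] [NormedStarGroup 𝔸] [StarModule ℂ 𝔸]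
    {W : Type*} [NormedAddCommGroup W] [InnerProductSpace ℂ W] [FiniteDimensional ℂ W] (φ : W ≃ₗ[ℂ] 𝔸) {c₀ : ℝ} [Fact (0 < c₀)]
    {Mφ Mφ' : ℝ} (hMφ : 0 ≤ Mφ) (hMφ' : 0 ≤ Mφ') (hφ : ∀ w, ‖φ w‖ ≤ Mφ * ‖w‖) (hφ' : ∀ X, ‖φ.symm X‖ ≤ Mφ' * ‖X‖)
    (τ : 𝔸 →ₗ[ℂ] ℂ) {Cτ : ℝ} (hτ : ∀ X, ‖τ X‖ ≤ Cτ * ‖X‖) (hCτ : 0 ≤ Cτ) {ρw : ℝ}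
    {η : ℝ} (hη : η ≠ 0) (hρ : |η| ^ d / c₀ ≤ ρw) (U : Bond d (towerP L m (n + 1)) → 𝔸ˣ)
    (hRS : ∀ (b : Bond d (towerP L m (n + 1))) (v u : W), ⟪adTransportW φ U b v, u⟫_ℂ = ⟪v, adTransportW φ (fun b => (U b)⁻¹) b u⟫_ℂ)
    (hUb : ∀ b, U b ∈ U1 𝔸) {α : ℝ} (hα0 : 0 ≤ α) (hα1 : α ≤ 1) (hUη : ∀ b, ‖(U b : 𝔸) - 1‖ ≤ α * η)
    (hpl : ∀ p : B9SectCLatticeCarrier.Plaq d (towerP L m (n + 1)), ‖(plaqHolU U p : 𝔸) - 1‖ ≤ α * η ^ 2)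
    (Gp : SiteL2K ℂ d (towerP L m (n + 1)) c₀ W →ₗ[ℂ] SiteL2K ℂ d (towerP L m (n + 1)) c₀ W) {Cl Cl' : ℝ} (hCl : 0 ≤ Cl) (hCl' : 0 ≤ Cl')
    (hlam : ∀ w : BondL2K ℂ d (towerP L m (n + 1)) c₀ W,
      ‖Gp (RofUk L m n φ η U (covDivL2K ℂ c₀ ((η : ℂ))⁻¹ (adTransportW φ fun b => (U b)⁻¹) w))‖ ≤
        Cl * Real.sqrt (‖covCurlL2K ℂ c₀ ((η : ℂ))⁻¹ (adTransportW φ (fun _ : Bond d (towerP L m (n + 1)) => (1 : 𝔸ˣ))) w‖ ^ 2 +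
          ‖covDivL2K ℂ c₀ ((η : ℂ))⁻¹ (adTransportW φ fun _ : Bond d (towerP L m (n + 1)) => (1 : 𝔸ˣ)⁻¹) w‖ ^ 2 + ‖w‖ ^ 2))
    (hDlam : ∀ w : BondL2K ℂ d (towerP L m (n + 1)) c₀ W,
      ‖covDerivL2K ℂ c₀ ((η : ℂ))⁻¹ (adTransportW φ U) (Gp (RofUk L m n φ η U (covDivL2K ℂ c₀ ((η : ℂ))⁻¹ (adTransportW φ fun b => (U b)⁻¹) w)))‖ ≤
        Cl' * Real.sqrt (‖covCurlL2K ℂ c₀ ((η : ℂ))⁻¹ (adTransportW φ (fun _ : Bond d (towerP L m (n + 1)) => (1 : 𝔸ˣ))) w‖ ^ 2 +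
          ‖covDivL2K ℂ c₀ ((η : ℂ))⁻¹ (adTransportW φ fun _ : Bond d (towerP L m (n + 1)) => (1 : 𝔸ˣ)⁻¹) w‖ ^ 2 + ‖w‖ ^ 2))
    (u v : BondL2K ℂ d (towerP L m (n + 1)) c₀ W) :
    ‖⟪u, (LinearMap.adjoint ((LinearMap.id : BondL2K ℂ d (towerP L m (n + 1)) c₀ W →ₗ[ℂ] BondL2K ℂ d (towerP L m (n + 1)) c₀ W) -
            covDerivL2K ℂ c₀ ((η : ℂ))⁻¹ (adTransportW φ U) ∘ₗ Gp ∘ₗ RofUk L m n φ η U ∘ₗ covDivL2K ℂ c₀ ((η : ℂ))⁻¹ (adTransportW φ fun b => (U b)⁻¹)) ∘ₗ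
          hessOp φ η U τ ∘ₗ
          ((LinearMap.id : BondL2K ℂ d (towerP L m (n + 1)) c₀ W →ₗ[ℂ] BondL2K ℂ d (towerP L m (n + 1)) c₀ W) -
            covDerivL2K ℂ c₀ ((η : ℂ))⁻¹ (adTransportW φ U) ∘ₗ Gp ∘ₗ RofUk L m n φ η U ∘ₗ covDivL2K ℂ c₀ ((η : ℂ))⁻¹ (adTransportW φ fun b => (U b)⁻¹))) v⟫_ℂ -
        ⟪u, hessOp φ η U τ v⟫_ℂ‖ ≤
      (2 * (2 * (Mφ' * Mφ) * Real.sqrt (Fintype.card (DirPair d)) * (1 + 8 * Real.sqrt d * (Mφ * Mφ')) * Cl + 32 * d * Cτ * Mφ ^ 2 * ρw * Cl') +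
          (2 * (Mφ' * Mφ) * Real.sqrt (Fintype.card (DirPair d))) ^ 2 * Cl ^ 2 + 32 * d * Cτ * Mφ ^ 2 * ρw * Cl' ^ 2) * α *
        Real.sqrt (‖covCurlL2K ℂ c₀ ((η : ℂ))⁻¹ (adTransportW φ (fun _ : Bond d (towerP L m (n + 1)) => (1 : 𝔸ˣ))) u‖ ^ 2 +
          ‖covDivL2K ℂ c₀ ((η : ℂ))⁻¹ (adTransportW φ fun _ : Bond d (towerP L m (n + 1)) => (1 : 𝔸ˣ)⁻¹) u‖ ^ 2 + ‖u‖ ^ 2) *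
        Real.sqrt (‖covCurlL2K ℂ c₀ ((η : ℂ))⁻¹ (adTransportW φ (fun _ : Bond d (towerP L m (n + 1)) => (1 : 𝔸ˣ))) v‖ ^ 2 +
          ‖covDivL2K ℂ c₀ ((η : ℂ))⁻¹ (adTransportW φ fun _ : Bond d (towerP L m (n + 1)) => (1 : 𝔸ˣ)⁻¹) v‖ ^ 2 + ‖v‖ ^ 2) := by
  have hc₀ : 0 < c₀ := Fact.out
  -- the letters as opaque reals
  obtain ⟨a, hadef⟩ : ∃ a : ℝ, a = 2 * (Mφ' * Mφ) * Real.sqrt (Fintype.card (DirPair d)) := ⟨_, rfl⟩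
  obtain ⟨b, hbdef⟩ : ∃ b : ℝ, b = 1 + 8 * Real.sqrt d * (Mφ * Mφ') := ⟨_, rfl⟩
  obtain ⟨κ, hκdef⟩ : ∃ κ : ℝ, κ = 32 * d * Cτ * Mφ ^ 2 * ρw := ⟨_, rfl⟩
  have ha0 : 0 ≤ a := by rw [hadef]; positivity
  have hb1 : 1 ≤ b := by rw [hbdef]; exact le_add_of_nonneg_right (by positivity)
  have hb0 : 0 ≤ b := zero_le_one.trans hb1
  have hρw0 : 0 ≤ ρw := le_trans (by positivity) hρ
  have hκ0 : 0 ≤ κ := by rw [hκdef]; positivity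
  -- the flat energy weight
  obtain ⟨N, hNdef⟩ : ∃ N : BondL2K ℂ d (towerP L m (n + 1)) c₀ W → ℝ, N = fun z =>
      Real.sqrt (‖covCurlL2K ℂ c₀ ((η : ℂ))⁻¹ (adTransportW φ (fun _ : Bond d (towerP L m (n + 1)) => (1 : 𝔸ˣ))) z‖ ^ 2 +
        ‖covDivL2K ℂ c₀ ((η : ℂ))⁻¹ (adTransportW φ fun _ : Bond d (towerP L m (n + 1)) => (1 : 𝔸ˣ)⁻¹) z‖ ^ 2 + ‖z‖ ^ 2) := ⟨_, rfl⟩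
  have hNz : ∀ z, N z = Real.sqrt (‖covCurlL2K ℂ c₀ ((η : ℂ))⁻¹ (adTransportW φ (fun _ : Bond d (towerP L m (n + 1)) => (1 : 𝔸ˣ))) z‖ ^ 2 +
        ‖covDivL2K ℂ c₀ ((η : ℂ))⁻¹ (adTransportW φ fun _ : Bond d (towerP L m (n + 1)) => (1 : 𝔸ˣ)⁻¹) z‖ ^ 2 + ‖z‖ ^ 2) := fun z => by rw [hNdef]
  have hN0 : ∀ z, 0 ≤ N z := fun z => by rw [hNz]; exact Real.sqrt_nonneg _
  have hNn : ∀ z, ‖z‖ ≤ N z := fun z => by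
    rw [hNz]; exact le_sqrt_of_sq_le (norm_nonneg _) (le_add_of_nonneg_left (add_nonneg (sq_nonneg _) (sq_nonneg _)))
  have hNc : ∀ z, ‖covCurlL2K ℂ c₀ ((η : ℂ))⁻¹ (adTransportW φ (fun _ : Bond d (towerP L m (n + 1)) => (1 : 𝔸ˣ))) z‖ ≤ N z := fun z => by
    rw [hNz]; exact le_sqrt_of_sq_le (norm_nonneg _) ((le_add_of_nonneg_right (sq_nonneg _)).trans (le_add_of_nonneg_right (sq_nonneg _)))
  -- the λ-letters in the weight
  set K : BondL2K ℂ d (towerP L m (n + 1)) c₀ W → BondL2K ℂ d (towerP L m (n + 1)) c₀ W := fun w =>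
    covDerivL2K ℂ c₀ ((η : ℂ))⁻¹ (adTransportW φ U) (Gp (RofUk L m n φ η U (covDivL2K ℂ c₀ ((η : ℂ))⁻¹ (adTransportW φ fun b => (U b)⁻¹) w))) with hKdef
  set lam : BondL2K ℂ d (towerP L m (n + 1)) c₀ W → SiteL2K ℂ d (towerP L m (n + 1)) c₀ W := fun w =>
    Gp (RofUk L m n φ η U (covDivL2K ℂ c₀ ((η : ℂ))⁻¹ (adTransportW φ fun b => (U b)⁻¹) w)) with hlamdef
  have hlamN : ∀ w, ‖lam w‖ ≤ Cl * N w := fun w => by rw [hNz]; exact hlam w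
  have hKN : ∀ w, ‖K w‖ ≤ Cl' * N w := fun w => by rw [hNz]; exact hDlam w
  -- unit bounds of the bond variables
  have hU1 : ∀ b : Bond d (towerP L m (n + 1)), ‖(U b : 𝔸)‖ ≤ 1 ∧ ‖(((U b)⁻¹ : 𝔸ˣ) : 𝔸)‖ ≤ 1 := fun b => mem_U1.1 (hUb b)
  have hαη2 : 0 ≤ α * η ^ 2 := by positivity
  -- the holonomy-commutator letter: `‖curl_U(D_Uλ)‖ ≤ a·α·‖λ‖`
  have hcurlK : ∀ w, ‖covCurlL2K ℂ c₀ ((η : ℂ))⁻¹ (adTransportW φ U) (K w)‖ ≤ a * α * (Cl * N w) := fun w => by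
    have h := norm_covCurlL2K_covDerivL2K_le_window φ hMφ hMφ' hφ hφ' hη hUb hα0 hpl (lam w)
    rw [← hadef] at h
    exact h.trans (mul_le_mul_of_nonneg_left (hlamN w) (mul_nonneg ha0 hα0))
  -- the curl at `U` against the flat weight: `‖curl_Uw‖ ≤ b·N₁(w)` (`0 ≤ α ≤ 1`)
  have hcurlU : ∀ w, ‖covCurlL2K ℂ c₀ ((η : ℂ))⁻¹ (adTransportW φ U) w‖ ≤ b * N w := fun w => by
    have hR : ∀ (b : Bond d (towerP L m (n + 1))) (x : W), ‖adTransportW φ U b x - x‖ ≤ 2 * Mφ * Mφ' * |α * η| * ‖x‖ := fun b x =>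
      B9Eq384RemainderLetters.norm_adTransportW_sub_le φ hφ hφ' hMφ' U b (hUb b) ((hUη b).trans (le_abs_self _)) x
    have hR₁ : ∀ (b : Bond d (towerP L m (n + 1))) (x : W), adTransportW φ (fun _ : Bond d (towerP L m (n + 1)) => (1 : 𝔸ˣ)) b x = x := fun b x => by
      rw [B9Eq310HessianOperator.adTransportW_apply]; simp
    have h := norm_covCurlL2K_sub_le ((η : ℂ))⁻¹ (by positivity : 0 ≤ 2 * Mφ * Mφ' * |α * η|) hR hR₁ w
    have hηc : ‖((η : ℂ))⁻¹‖ * |α * η| = α := by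
      rw [norm_inv, Complex.norm_real, Real.norm_eq_abs, abs_mul, abs_of_nonneg hα0]
      field_simp
    have h2 : 4 * Real.sqrt d * (‖((η : ℂ))⁻¹‖ * (2 * Mφ * Mφ' * |α * η|)) = 8 * Real.sqrt d * (Mφ * Mφ') * α := by
      rw [show ‖((η : ℂ))⁻¹‖ * (2 * Mφ * Mφ' * |α * η|) = 2 * Mφ * Mφ' * (‖((η : ℂ))⁻¹‖ * |α * η|) by ring, hηc]; ring
    rw [h2] at h
    have h3 : ‖covCurlL2K ℂ c₀ ((η : ℂ))⁻¹ (adTransportW φ U) w‖ ≤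
        ‖covCurlL2K ℂ c₀ ((η : ℂ))⁻¹ (adTransportW φ (fun _ : Bond d (towerP L m (n + 1)) => (1 : 𝔸ˣ))) w‖ + 8 * Real.sqrt d * (Mφ * Mφ') * α * ‖w‖ :=
      (norm_le_insert' _ _).trans (add_le_add le_rfl h)
    have h4 : 8 * Real.sqrt d * (Mφ * Mφ') * α * ‖w‖ ≤ 8 * Real.sqrt d * (Mφ * Mφ') * N w := by
      have : α * ‖w‖ ≤ 1 * N w := mul_le_mul hα1 (hNn w) (norm_nonneg _) zero_le_one
      nlinarith [this, Real.sqrt_nonneg (d : ℝ), mul_nonneg hMφ hMφ']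
    calc _ ≤ N w + 8 * Real.sqrt d * (Mφ * Mφ') * N w := (h3.trans (add_le_add (hNc w) h4))
      _ = b * N w := by rw [hbdef]; ring
  -- the curvature letter at the plaquette window: `κ·α`
  have hcurv : ∀ x y : BondL2K ℂ d (towerP L m (n + 1)) c₀ W, ‖⟪x, curvOp φ τ η U y⟫_ℂ‖ ≤ κ * α * ‖y‖ * ‖x‖ := fun x y => by
    have h := norm_inner_curvOp_le φ hτ hCτ hφ η hU1 hpl hMφ hαη2 x y
    have hn : ‖((η : ℂ))⁻¹‖ ^ 2 * (α * η ^ 2) = α := by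
      rw [norm_inv, Complex.norm_real, Real.norm_eq_abs, inv_pow, sq_abs]; field_simp
    rw [hn] at h
    refine h.trans ?_
    have : 32 * d * Cτ * Mφ ^ 2 * (|η| ^ d / c₀) * α ≤ κ * α := by
      rw [hκdef]; exact mul_le_mul_of_nonneg_right (mul_le_mul_of_nonneg_left hρ (by positivity)) hα0
    nlinarith [this, norm_nonneg x, norm_nonneg y, mul_nonneg (norm_nonneg y) (norm_nonneg x)]
  -- `|⟨x, Δ^η(K w)⟩| ≤ (‖curl_Ux‖·aC_λ + κC_λ′‖x‖)·α·N(w)` and the left-mode twin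
  have hmode : ∀ x w : BondL2K ℂ d (towerP L m (n + 1)) c₀ W, ‖⟪x, hessOp φ η U τ (K w)⟫_ℂ‖ ≤
      (‖covCurlL2K ℂ c₀ ((η : ℂ))⁻¹ (adTransportW φ U) x‖ * (a * Cl) + κ * Cl' * ‖x‖) * α * N w := fun x w => by
    rw [hessOp_apply, inner_add_right]
    refine (norm_add_le _ _).trans ?_
    have h1 := norm_inner_principalOpK_le φ η hRS x (K w)
    have h2 := hcurv x (K w)
    have e1 : ‖covCurlL2K ℂ c₀ ((η : ℂ))⁻¹ (adTransportW φ U) x‖ * ‖covCurlL2K ℂ c₀ ((η : ℂ))⁻¹ (adTransportW φ U) (K w)‖ ≤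
        ‖covCurlL2K ℂ c₀ ((η : ℂ))⁻¹ (adTransportW φ U) x‖ * (a * α * (Cl * N w)) := mul_le_mul_of_nonneg_left (hcurlK w) (norm_nonneg _)
    have e2 : κ * α * ‖K w‖ * ‖x‖ ≤ κ * α * (Cl' * N w) * ‖x‖ :=
      mul_le_mul_of_nonneg_right (mul_le_mul_of_nonneg_left (hKN w) (mul_nonneg hκ0 hα0)) (norm_nonneg _)
    calc _ ≤ ‖covCurlL2K ℂ c₀ ((η : ℂ))⁻¹ (adTransportW φ U) x‖ * (a * α * (Cl * N w)) + κ * α * (Cl' * N w) * ‖x‖ := add_le_add (h1.trans e1) (h2.trans e2)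
      _ = (‖covCurlL2K ℂ c₀ ((η : ℂ))⁻¹ (adTransportW φ U) x‖ * (a * Cl) + κ * Cl' * ‖x‖) * α * N w := by ring
  have hmode' : ∀ x w : BondL2K ℂ d (towerP L m (n + 1)) c₀ W, ‖⟪K w, hessOp φ η U τ x⟫_ℂ‖ ≤
      (‖covCurlL2K ℂ c₀ ((η : ℂ))⁻¹ (adTransportW φ U) x‖ * (a * Cl) + κ * Cl' * ‖x‖) * α * N w := fun x w => by
    rw [hessOp_apply, inner_add_right]
    refine (norm_add_le _ _).trans ?_
    have h1 := norm_inner_principalOpK_le φ η hRS (K w) x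
    have h2 := hcurv (K w) x
    have e1 : ‖covCurlL2K ℂ c₀ ((η : ℂ))⁻¹ (adTransportW φ U) (K w)‖ * ‖covCurlL2K ℂ c₀ ((η : ℂ))⁻¹ (adTransportW φ U) x‖ ≤
        (a * α * (Cl * N w)) * ‖covCurlL2K ℂ c₀ ((η : ℂ))⁻¹ (adTransportW φ U) x‖ := mul_le_mul_of_nonneg_right (hcurlK w) (norm_nonneg _)
    have e2 : κ * α * ‖x‖ * ‖K w‖ ≤ κ * α * ‖x‖ * (Cl' * N w) :=
      mul_le_mul_of_nonneg_left (hKN w) (mul_nonneg (mul_nonneg hκ0 hα0) (norm_nonneg _))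
    calc _ ≤ (a * α * (Cl * N w)) * ‖covCurlL2K ℂ c₀ ((η : ℂ))⁻¹ (adTransportW φ U) x‖ + κ * α * ‖x‖ * (Cl' * N w) := add_le_add (h1.trans e1) (h2.trans e2)
      _ = (‖covCurlL2K ℂ c₀ ((η : ℂ))⁻¹ (adTransportW φ U) x‖ * (a * Cl) + κ * Cl' * ‖x‖) * α * N w := by ring
  -- the expansion `⟨u, π†Δπv⟩ − ⟨u, Δv⟩ = −⟨u, ΔKv⟩ − ⟨Ku, Δv⟩ + ⟨Ku, ΔKv⟩`
  have hπ : ∀ w, ((LinearMap.id : BondL2K ℂ d (towerP L m (n + 1)) c₀ W →ₗ[ℂ] BondL2K ℂ d (towerP L m (n + 1)) c₀ W) -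
      covDerivL2K ℂ c₀ ((η : ℂ))⁻¹ (adTransportW φ U) ∘ₗ Gp ∘ₗ RofUk L m n φ η U ∘ₗ covDivL2K ℂ c₀ ((η : ℂ))⁻¹ (adTransportW φ fun b => (U b)⁻¹)) w =
      w - K w := fun w => by
    simp only [LinearMap.sub_apply, LinearMap.id_apply, LinearMap.comp_apply, hKdef]
  have hexp : ⟪u, (LinearMap.adjoint ((LinearMap.id : BondL2K ℂ d (towerP L m (n + 1)) c₀ W →ₗ[ℂ] BondL2K ℂ d (towerP L m (n + 1)) c₀ W) -
            covDerivL2K ℂ c₀ ((η : ℂ))⁻¹ (adTransportW φ U) ∘ₗ Gp ∘ₗ RofUk L m n φ η U ∘ₗ covDivL2K ℂ c₀ ((η : ℂ))⁻¹ (adTransportW φ fun b => (U b)⁻¹)) ∘ₗ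
          hessOp φ η U τ ∘ₗ
          ((LinearMap.id : BondL2K ℂ d (towerP L m (n + 1)) c₀ W →ₗ[ℂ] BondL2K ℂ d (towerP L m (n + 1)) c₀ W) -
            covDerivL2K ℂ c₀ ((η : ℂ))⁻¹ (adTransportW φ U) ∘ₗ Gp ∘ₗ RofUk L m n φ η U ∘ₗ covDivL2K ℂ c₀ ((η : ℂ))⁻¹ (adTransportW φ fun b => (U b)⁻¹))) v⟫_ℂ -
        ⟪u, hessOp φ η U τ v⟫_ℂ =
      -⟪u, hessOp φ η U τ (K v)⟫_ℂ - ⟪K u, hessOp φ η U τ v⟫_ℂ + ⟪K u, hessOp φ η U τ (K v)⟫_ℂ := by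
    rw [LinearMap.comp_apply, LinearMap.comp_apply, LinearMap.adjoint_inner_right, hπ, hπ, map_sub, inner_sub_left, inner_sub_right, inner_sub_right]
    ring
  rw [hexp]
  -- scalar assembly
  have hNu := hN0 u; have hNv := hN0 v
  have hcu := hcurlU u; have hcv := hcurlU v
  have T1 := hmode u v
  have T2 := hmode' v u
  have T3 := hmode (K u) v
  have hcKu := hcurlK u
  have hKu := hKN u
  -- bound the brackets of T1, T2 by `(b·aC_λ + κC_λ′)·N`
  have hB1 : ‖covCurlL2K ℂ c₀ ((η : ℂ))⁻¹ (adTransportW φ U) u‖ * (a * Cl) + κ * Cl' * ‖u‖ ≤ (b * (a * Cl) + κ * Cl') * N u := by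
    have e1 := mul_le_mul_of_nonneg_right hcu (mul_nonneg ha0 hCl)
    have e2 := mul_le_mul_of_nonneg_left (hNn u) (mul_nonneg hκ0 hCl')
    linarith
  have hB2 : ‖covCurlL2K ℂ c₀ ((η : ℂ))⁻¹ (adTransportW φ U) v‖ * (a * Cl) + κ * Cl' * ‖v‖ ≤ (b * (a * Cl) + κ * Cl') * N v := by
    have e1 := mul_le_mul_of_nonneg_right hcv (mul_nonneg ha0 hCl)
    have e2 := mul_le_mul_of_nonneg_left (hNn v) (mul_nonneg hκ0 hCl')
    linarith
  -- the bracket of T3 by `(aαC_λ·aC_λ + κC_λ′²)·N u` using `α ≤ 1`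
  have hB3 : ‖covCurlL2K ℂ c₀ ((η : ℂ))⁻¹ (adTransportW φ U) (K u)‖ * (a * Cl) + κ * Cl' * ‖K u‖ ≤ (a * Cl * (a * Cl) + κ * Cl' * Cl') * N u := by
    have e1 : ‖covCurlL2K ℂ c₀ ((η : ℂ))⁻¹ (adTransportW φ U) (K u)‖ ≤ a * Cl * N u := by
      refine hcKu.trans ?_
      have : a * α * (Cl * N u) ≤ a * 1 * (Cl * N u) := by gcongr
      linarith
    have e1' := mul_le_mul_of_nonneg_right e1 (mul_nonneg ha0 hCl)
    have e2 := mul_le_mul_of_nonneg_left hKu (mul_nonneg hκ0 hCl')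
    nlinarith [e1', e2]
  have hT1 : ‖⟪u, hessOp φ η U τ (K v)⟫_ℂ‖ ≤ (b * (a * Cl) + κ * Cl') * α * N u * N v := by
    refine T1.trans ?_
    have := mul_le_mul_of_nonneg_right (mul_le_mul_of_nonneg_right hB1 hα0) hNv
    linarith
  have hT2 : ‖⟪K u, hessOp φ η U τ v⟫_ℂ‖ ≤ (b * (a * Cl) + κ * Cl') * α * N u * N v := by
    refine T2.trans ?_
    have := mul_le_mul_of_nonneg_right (mul_le_mul_of_nonneg_right hB2 hα0) hNu
    linarith [show (b * (a * Cl) + κ * Cl') * N v * α * N u = (b * (a * Cl) + κ * Cl') * α * N u * N v by ring]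
  have hT3 : ‖⟪K u, hessOp φ η U τ (K v)⟫_ℂ‖ ≤ (a * Cl * (a * Cl) + κ * Cl' * Cl') * α * N u * N v := by
    refine T3.trans ?_
    have := mul_le_mul_of_nonneg_right (mul_le_mul_of_nonneg_right hB3 hα0) hNv
    linarith
  have hfin : ‖-⟪u, hessOp φ η U τ (K v)⟫_ℂ - ⟪K u, hessOp φ η U τ v⟫_ℂ + ⟪K u, hessOp φ η U τ (K v)⟫_ℂ‖ ≤
      (2 * (b * (a * Cl) + κ * Cl') + a ^ 2 * Cl ^ 2 + κ * Cl' ^ 2) * α * N u * N v := by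
    calc _ ≤ ‖-⟪u, hessOp φ η U τ (K v)⟫_ℂ - ⟪K u, hessOp φ η U τ v⟫_ℂ‖ + ‖⟪K u, hessOp φ η U τ (K v)⟫_ℂ‖ := norm_add_le _ _
      _ ≤ ‖-⟪u, hessOp φ η U τ (K v)⟫_ℂ‖ + ‖⟪K u, hessOp φ η U τ v⟫_ℂ‖ + ‖⟪K u, hessOp φ η U τ (K v)⟫_ℂ‖ := add_le_add (norm_sub_le _ _) le_rfl
      _ = ‖⟪u, hessOp φ η U τ (K v)⟫_ℂ‖ + ‖⟪K u, hessOp φ η U τ v⟫_ℂ‖ + ‖⟪K u, hessOp φ η U τ (K v)⟫_ℂ‖ := by rw [norm_neg]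
      _ ≤ _ := by nlinarith [hT1, hT2, hT3]
  rw [hNz u, hNz v] at hfin
  rw [← hadef, ← hbdef, ← hκdef]
  convert hfin using 2
  ring

end Literature.MathematicalPhysics.QuantumFieldTheory.Balaban1983to89.B9Eq3120DeltaPiPrimeFormDiagonal

end
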